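import Summits.AtomisticToContinuum.HydrodynamicLimit.Theorems.OneFlightGossipEngineEnergyCurrentTailsLevelCensusSplitFloorRung0Pathwise
import Summits.AtomisticToContinuum.HydrodynamicLimit.Theorems.OneFlightGossipEngineEnergyCurrentTailsLevelCensusSplitFloorRung0Statics
import Summits.AtomisticToContinuum.HydrodynamicLimit.Theorems.OneFlightGossipEngineEnergyCurrentTailsLevelCensusSplitFloorRung0TubeMean
import Summits.AtomisticToContinuum.HydrodynamicLimit.Theorems.OneFlightGossipEngineEnergyCurrentTailsLevelCensusSplitFloorRung0Geometry
import Summits.AtomisticToContinuum.HydrodynamicLimit.Theorems.OneFlightGossipEngineEnergyCurrentTailsEnergyFluxCeilingRung0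
import Summits.AtomisticToContinuum.HydrodynamicLimit.Theorems.JParityClosureOddContactSymmetryGibbsInvariance
import Literature.MathematicalPhysics.KineticTheory.HardSphereTwoTimePressure
import HarnessLib

/-!
# Splitting floor at rung 0: the registered stub `stub_splitFloorRung0` (line `level-census-comparison`, crux
# `EnergyCurrentTails`, stmt-AtomisticToContinuum-9235) — expected window floors and the assembly

The RUNG-0 (global equilibrium, constant profiles) CERTIFICATE of the splitting floor F3 (`SplitFloor` of
`…Theorems.OneFlightGossipEngineEnergyCurrentTailsLevelCensusObjects`): under the homogeneous Gibbs law `G_N`, which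
every hard-sphere flow preserves (`measurePreserving_flow_localGibbsLaw_const`), particles of the energy shell
`(E, 3E/2]` undergo SPLITTING collisions at a fixed fraction of the Boltzmann rate `κ_N √E`, in expectation, over every
window `(s, s']` (`stub_splitFloorRung0`, registered; shape of `SplitFloor` verbatim with `c = c(u, θb)`, `N₃ = 1`).
Fixed-`N` small-window argument (no contact theorem, no special-flow representation):

* `splitFloorRung0_window` — for a window `(r, r + h]` and the splitting mark `Ξ` of `…SplitFloorRung0Geometry`:
  `(N+1) N (1 − 16λ) ε_N² h Θ̄_Ξ ≤ 2 E_{G_N}[# splitting collisions in (r, r + h]] + C_N h²` (integrate the pathwise floor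
  `splitFloorRung0_pathwise` along `Φ_r`; the static tube sum has mean `≥ (N+1)N(1 − 16λ)ε³κΘ̄`,
  `splitFloorRung0_tubeMean`; the pair excess has mean `≤ C_N h²`, `splitFloorRung0_statics`);
* `sum_eventCount_le` — expected counts of consecutive windows add up (pathwise additivity on the good set);
* `le_of_forall_nat_le_add` — the limit `K → ∞` of `K` windows of length `(s' − s)/K` kills `C_N (s'−s)²/K`;
* assembly: `Θ̄_Ξ ≥ c_geo √E N(u,θb)(shell)` (`splitFloorRung0_geometry`), the census at time `s` is `(N+1) N(u,θb)(shell)`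
  at rung 0 (`shellCensus_const`) and bounds the infimum over `[s, s']`, `(N+1) ε_N² = κ_N`, `1 − 16λ ≥ 1/2`, `N ≥ (N+1)/2`.

References: Cercignani–Illner–Pulvirenti 1994 §2.2, App. 4.A; Ruelle 1969 §4.2; Gallagher–Saint-Raymond–Texier 2013 §4.1.
-/

noncomputable section

open MeasureTheory Set Filter
open scoped ENNReal InnerProductSpace BigOperators Classical

namespace Summit.AtomisticToContinuum.HydrodynamicLimit.Theorems.EnergyCurrentTailsLevelCensus

open Literature.MathematicalPhysics.KineticTheory Literature.Analysis.FluidPDE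
open Literature.MathematicalPhysics.StatisticalMechanics RateFloorLine

variable {σ : ℝ} {N : ℕ}

/-! ## Rung-0 statics of the census (private copies of `…LevelCensusMergeClasses` lemmas) -/

/-- No collisions in an empty window. [folklore] -/
private theorem eventSum_self' (Φ : Flow σ N) (s : ℝ) (S : Set VelEvent) (z : Config (N + 1) (Fin 3) T3) :
    eventSum Φ s s S z = 0 := by
  simp only [eventSum, HardSphereFlow.collisionSum_eq, Literature.Analysis.FluidPDE.collisionSum_eq_collisionPairSum,
    Set.Ioc_self, collisionPairSum_empty]

/-- **The shell census at rung 0** is `(N+1) · N(u,θ̄){E₁ < ‖v‖² ≤ E₂}` at every time (stationarity of `G_N` and the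
one-body velocity marginal; public copy `shellCensus_const` in `…LevelCensusMergeClasses`). [folklore] -/
private theorem shellCensus_const' (hσ : σ ≤ 1 / 2) {a θb : ℝ} (ha : 0 < a) (hθ : 0 < θb) (u : V3) (N : ℕ)
    (Φ : HardSphereFlow (Torus.geometry (Fin 3)) (hsDiameter σ N) (N + 1)) (r E₁ E₂ : ℝ) :
    shellCensus σ (fun _ => a) (fun _ => θb) (fun _ => u) N Φ r E₁ E₂ =
      ((N + 1 : ℕ) : ℝ≥0∞) * gaussMeasure u θb {v : V3 | E₁ < ‖v‖ ^ 2 ∧ ‖v‖ ^ 2 ≤ E₂} := by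
  set S : Set V3 := {v : V3 | E₁ < ‖v‖ ^ 2 ∧ ‖v‖ ^ 2 ≤ E₂} with hSdef
  have hS : MeasurableSet S := (measurableSet_lt measurable_const (continuous_norm.measurable.pow_const 2)).inter
    (measurableSet_le (continuous_norm.measurable.pow_const 2) measurable_const)
  have hterm : ∀ i : Fin (N + 1), Measurable fun w : Config (N + 1) (Fin 3) T3 =>
      S.indicator (fun _ => (1 : ℝ≥0∞)) ((w i).2) := fun i => (measurable_const.indicator hS).comp (measurable_pi_apply i).snd
  have hgm : Measurable fun w : Config (N + 1) (Fin 3) T3 => ∑ i : Fin (N + 1), S.indicator (fun _ => (1 : ℝ≥0∞)) ((w i).2) :=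
    Finset.measurable_sum _ fun i _ => hterm i
  calc shellCensus σ (fun _ => a) (fun _ => θb) (fun _ => u) N Φ r E₁ E₂
      = ∫⁻ z, (∑ i : Fin (N + 1), S.indicator (fun _ => (1 : ℝ≥0∞)) ((z i).2))
          ∂(localGibbsLaw σ (fun _ => a) (fun _ => u) (fun _ => θb) N Φ) :=
        lintegral_comp_flow_localGibbsLaw_const σ a θb u N Φ r hgm
    _ = ∑ i : Fin (N + 1), ∫⁻ z, S.indicator (fun _ => (1 : ℝ≥0∞)) ((z i).2)
          ∂(localGibbsLaw σ (fun _ => a) (fun _ => u) (fun _ => θb) N Φ) := lintegral_finsetSum _ fun i _ => hterm i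
    _ = ∑ _i : Fin (N + 1), gaussMeasure u θb S := by
        refine Finset.sum_congr rfl fun i _ => ?_
        rw [QuarticSchurLedger.lintegral_vel_localGibbsLaw_drift hσ ha hθ u N Φ i (measurable_const.indicator hS),
          lintegral_indicator_const hS, one_mul]
    _ = ((N + 1 : ℕ) : ℝ≥0∞) * gaussMeasure u θb S := by rw [Finset.sum_const, Finset.card_univ, Fintype.card_fin, nsmul_eq_mul]

/-! ## Measurability of the splitting event -/

/-- The splitting event is a Borel set of velocity events (public copy in `…LevelCensusClosureEvents`). [folklore] -/
private theorem measurableSet_splitEvent' (E : ℝ) : MeasurableSet (splitEvent E) := by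
  have h1 : Measurable fun q : VelEvent => maxPre q := by unfold maxPre; fun_prop
  have h2 : Measurable fun q : VelEvent => ‖q.2.1‖ ^ 2 := by fun_prop
  have h3 : Measurable fun q : VelEvent => ‖q.2.2‖ ^ 2 := by fun_prop
  simp only [splitEvent, Set.setOf_and]
  exact (measurableSet_lt measurable_const h1).inter ((measurableSet_le h1 measurable_const).inter
    ((measurableSet_le h2 measurable_const).inter (measurableSet_le h3 measurable_const)))

/-! ## Additivity of the splitting count over consecutive windows -/

/-- **Pathwise additivity**: on the good set, the velocity-event count of `(s, s + K h]` is the sum of the counts of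
the `K` consecutive windows `(s + k h, s + k h + h]` (`h ≥ 0`; `collisionPairSum_union`). [folklore] -/
theorem eventSum_eq_sum_range (Φ : Flow σ N) {z : Config (N + 1) (Fin 3) T3} (hz : z ∈ Φ.good) (s : ℝ) {h : ℝ}
    (hh : 0 ≤ h) (S : Set VelEvent) (K : ℕ) :
    eventSum Φ s (s + K * h) S z = ∑ k ∈ Finset.range K, eventSum Φ (s + k * h) (s + k * h + h) S z := by
  induction K with
  | zero => simp only [Nat.cast_zero, zero_mul, add_zero, eventSum_self', Finset.range_zero, Finset.sum_empty]
  | succ K ih =>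
    rw [Finset.sum_range_succ, ← ih]
    have hK : (0 : ℝ) ≤ K * h := mul_nonneg K.cast_nonneg hh
    have hunion : Set.Ioc s (s + ((K + 1 : ℕ) : ℝ) * h) = Set.Ioc s (s + K * h) ∪ Set.Ioc (s + K * h) (s + K * h + h) := by
      rw [Set.Ioc_union_Ioc_eq_Ioc (by linarith) (by linarith)]
      push_cast
      ring_nf
    have hdisj : Disjoint (Set.Ioc s (s + K * h)) (Set.Ioc (s + K * h) (s + K * h + h)) :=
      Set.disjoint_left.2 fun x hx hx' => absurd hx'.1 (not_lt.2 hx.2)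
    simp only [eventSum, HardSphereFlow.collisionSum_eq, Literature.Analysis.FluidPDE.collisionSum_eq_collisionPairSum]
    rw [hunion, collisionPairSum_union (Φ.finite_collisionTimes_inter hz Set.Ioc_subset_Icc_self)
      (Φ.finite_collisionTimes_inter hz Set.Ioc_subset_Icc_self) hdisj]

/-- **Expected additivity (inequality form)**: for `0 < σ < 1/2`, a Borel `S` and `h ≥ 0`, the expected counts of
the `K` consecutive windows add up to at most the expected count of `(s, s + K h]` (in fact equality; the counts are
a.e.-measurable, `aemeasurable_eventSum`, and the good set is conull, `ae_mem_good_localGibbsLaw`). [folklore] -/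
theorem sum_eventCount_le (hσ : 0 < σ) (hσ2 : σ < 1 / 2) (a₀ θ₀ : T3 → ℝ) (u₀ : T3 → V3) (Φ : Flow σ N) (s : ℝ)
    {h : ℝ} (hh : 0 ≤ h) {S : Set VelEvent} (hS : MeasurableSet S) (K : ℕ) :
    ∑ k ∈ Finset.range K, eventCount σ a₀ θ₀ u₀ N Φ (s + k * h) (s + k * h + h) S ≤
      eventCount σ a₀ θ₀ u₀ N Φ s (s + K * h) S := by
  have hgood := ae_mem_good_localGibbsLaw σ a₀ u₀ θ₀ N Φ
  unfold eventCount
  rw [← lintegral_finsetSum' _ fun k _ => aemeasurable_eventSum hσ hσ2 Φ _ _ hS hgood]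
  refine le_of_eq (lintegral_congr_ae ?_)
  filter_upwards [hgood] with z hz
  exact (eventSum_eq_sum_range Φ hz s hh S K).symm

/-! ## The elementary limit -/

/-- If `x ≤ y + B/K` for all large positive integers `K` (`B ≥ 0`), then `x ≤ y` (in `ℝ≥0∞`). [folklore] -/
theorem le_of_forall_nat_le_add {x y : ℝ≥0∞} {B : ℝ} (hB : 0 ≤ B) (K₀ : ℕ)
    (h : ∀ K : ℕ, K₀ ≤ K → 0 < K → x ≤ y + ENNReal.ofReal (B / K)) : x ≤ y := by
  refine ENNReal.le_of_forall_pos_le_add fun δ hδ _ => ?_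
  obtain ⟨n, hn⟩ := exists_nat_gt (B / δ)
  have hδ' : (0 : ℝ) < δ := hδ
  have hn0 : 0 < n := by
    have : (0 : ℝ) < n := lt_of_le_of_lt (div_nonneg hB hδ'.le) hn
    exact_mod_cast this
  set K := max K₀ n with hK
  have hKn : (n : ℝ) ≤ K := by exact_mod_cast le_max_right K₀ n
  have hK0 : (0 : ℝ) < K := lt_of_lt_of_le (by exact_mod_cast hn0) hKn
  have hBK : B / K ≤ δ := by
    rw [div_le_iff₀ hK0]
    have h1 : B < n * δ := by rwa [div_lt_iff₀ hδ'] at hn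
    nlinarith
  calc x ≤ y + ENNReal.ofReal (B / K) := h K (le_max_left _ _) (lt_of_lt_of_le hn0 (le_max_right _ _))
    _ ≤ y + δ := by
        gcongr
        calc ENNReal.ofReal (B / K) ≤ ENNReal.ofReal δ := ENNReal.ofReal_le_ofReal hBK
          _ = δ := ENNReal.ofReal_coe_nnreal

/-! ## The expected floor of one window -/

/-- **The expected floor of one window.**  For constant profiles, small
density, a flow `Φ`, a level `E`, a measurable mark `0 ≤ Ξ ≤ 1` vanishing at relative speed `≥ 2L` and at speed
`≥ 2L` (`L ≥ 0`) and nonzero only on the splitting geometry of level `E`, and a window `(r, r + h]`, `h > 0`, with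
`ε_N + 4 L h < 1/2`:
`(N+1) N (1 − 16λ) ε_N² h Θ̄_Ξ ≤ 2 · eventCount r (r + h) (splitEvent E) + ((N+1)⁷ + (N+1)⁸) 1024 ε_N⁴ (‖u‖² + 3θ) h²`.
[folklore] -/
theorem splitFloorRung0_window : ∀ (σ : ℝ), 0 < σ → σ < 1 / 2 → SmallDensity uniformProfile σ → ∀ (a θ : ℝ), 0 < a → 0 < θ → ∀ (u : V3) (N : ℕ) (Φ : Flow σ N) (E L : ℝ), 0 ≤ L → ∀ (Ξ : V3 × V3 × V3 → ℝ), Measurable Ξ → (∀ q, 0 ≤ Ξ q) → (∀ q, Ξ q ≤ 1) → (∀ m v v' : V3, 2 * L ≤ ‖v - v'‖ → Ξ (m, v, v') = 0) → (∀ m v v' : V3, 2 * L ≤ ‖v‖ → Ξ (m, v, v') = 0) → (∀ n v w : V3, ‖n‖ = 1 → Ξ (n, v, w) ≠ 0 → (((v, w), (v - ⟪v - w, n⟫_ℝ • n, w + ⟪v - w, n⟫_ℝ • n)) : VelEvent) ∈ splitEvent E) → ∀ (r h : ℝ), 0 < h → hsDiameter σ N + 4 * L * h < 1 / 2 → ENNReal.ofReal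 (((N + 1 : ℕ) : ℝ) * N * ((1 - 16 * ovDensity uniformProfile σ) * hsDiameter σ N ^ 2 * h * ∫ p : V3 × V3, sphereMark Ξ p.1 p.2 * (localMaxwellian 1 θ u p.1 * localMaxwellian 1 θ u p.2))) ≤ 2 * eventCount σ (fun _ => a) (fun _ => θ) (fun _ => u) N Φ r (r + h) (splitEvent E) + ENNReal.ofReal ((((N + 1 : ℕ) : ℝ) ^ 7 + ((N + 1 : ℕ) : ℝ) ^ 8) * (1024 * hsDiameter σ N ^ 4 * (‖u‖ ^ 2 + 3 * θ) * h ^ 2)) := by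
  intro σ hσ hσ2 hsd a θ ha hθ u N Φ E L hL Ξ hΞm hΞ0 hΞ1 hΞL hΞV hΞs r h hh hsmall
  have hε : 0 < hsDiameter σ N := hsDiameter_pos hσ N
  set κ : ℝ := h / hsDiameter σ N with hκdef
  have hκ : 0 < κ := div_pos hh hε
  have hκε : κ * hsDiameter σ N = h := div_mul_cancel₀ h hε.ne'
  have hsmallP : hsDiameter σ N * (1 + 4 * κ * L) < 1 / 2 := by
    have : hsDiameter σ N * (1 + 4 * κ * L) = hsDiameter σ N + 4 * L * h := by rw [← hκε]; ring
    rw [this]; exact hsmall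
  have hsmallT : hsDiameter σ N * (1 + 2 * L * κ) < 1 / 2 := by
    have : hsDiameter σ N * (1 + 2 * L * κ) ≤ hsDiameter σ N * (1 + 4 * κ * L) := by
      have : 0 ≤ L * κ := mul_nonneg hL hκ.le
      nlinarith
    exact this.trans_lt hsmallP
  set P := localGibbsLaw σ (fun _ => a) (fun _ => u) (fun _ => θ) N Φ with hPdef
  haveI : IsProbabilityMeasure P := isProbabilityMeasure_localGibbsLaw continuous_const continuous_const
    continuous_const (fun _ => ha) (fun _ => hθ) hσ2.le N Φ
  -- the static tube sum and its measurability
  set tube : Config (N + 1) (Fin 3) T3 → ℝ := fun w => ∑ i : Fin (N + 1), ∑ j : Fin (N + 1),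
    (if i ≠ j then pairTubeMark (hsDiameter σ N) κ Ξ i j (fun m => (w m).1) (fun m => (w m).2) else 0) with htube
  have htubem : Measurable tube := by
    refine Finset.measurable_sum _ fun i _ => Finset.measurable_sum _ fun j _ => ?_
    by_cases hij : i ≠ j
    · simp only [if_pos hij]; exact measurable_pairTubeMark_config (hsDiameter σ N) κ hΞm i j
    · simp only [if_neg hij]; exact measurable_const
  have hΞabs : ∀ q, |Ξ q| ≤ 1 := fun q => by rw [abs_of_nonneg (hΞ0 q)]; exact hΞ1 q
  have hptm0 : ∀ (i j : Fin (N + 1)) (x : Fin (N + 1) → T3) (v : Fin (N + 1) → V3),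
      0 ≤ pairTubeMark (hsDiameter σ N) κ Ξ i j x v := fun i j x v => by
    unfold pairTubeMark tubeMark; split_ifs <;> [exact hΞ0 _; exact le_rfl]
  have htube0 : ∀ w, 0 ≤ tube w := fun w => Finset.sum_nonneg fun i _ => Finset.sum_nonneg fun j _ => by
    split_ifs <;> [exact hptm0 _ _ _ _; exact le_rfl]
  have htubeb : ∀ w, ‖tube w‖ ≤ ((N + 1 : ℕ) : ℝ) * ((N + 1 : ℕ) : ℝ) := fun w => by
    rw [Real.norm_eq_abs, abs_of_nonneg (htube0 w), htube]
    calc (∑ i : Fin (N + 1), ∑ j : Fin (N + 1),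
          (if i ≠ j then pairTubeMark (hsDiameter σ N) κ Ξ i j (fun m => (w m).1) (fun m => (w m).2) else 0))
        ≤ ∑ _i : Fin (N + 1), ∑ _j : Fin (N + 1), (1 : ℝ) := Finset.sum_le_sum fun i _ => Finset.sum_le_sum fun j _ => by
          split_ifs <;> [exact (le_abs_self _).trans (abs_pairTubeMark_le _ _ hΞabs i j _ _); exact zero_le_one]
      _ = ((N + 1 : ℕ) : ℝ) * ((N + 1 : ℕ) : ℝ) := by
          simp only [Finset.sum_const, Finset.card_univ, Fintype.card_fin, nsmul_eq_mul, mul_one]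
  have htubei : Integrable tube P := Integrable.of_bound htubem.aestronglyMeasurable _ (ae_of_all _ htubeb)
  -- the statics
  obtain ⟨M, hMm, hMD, hMI⟩ := splitFloorRung0_statics σ hσ hσ2.le hsd a θ ha hθ u N Φ h hh
  -- the pathwise floor along `Φ_r`, a.e.
  have hae : ∀ᵐ z ∂P, ENNReal.ofReal (tube (Φ.flow r z)) ≤
      2 * eventSum Φ r (r + h) (splitEvent E) z + M (Φ.flow r z) := by
    filter_upwards [ae_mem_good_localGibbsLaw σ (fun _ => a) (fun _ => u) (fun _ => θ) N Φ] with z hz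
    have hP := splitFloorRung0_pathwise σ hσ hσ2 N Φ z hz r κ L L E hκ hsmallP Ξ hΞ0 hΞ1 hΞL hΞV hΞs
    rw [hκε] at hP
    exact hP.trans (add_le_add le_rfl (hMD _ (Φ.good_subset (Φ.mapsTo_good r hz))))
  -- integrate: invariance of `G_N` under `Φ_r`
  have e1 : ∫⁻ z, ENNReal.ofReal (tube (Φ.flow r z)) ∂P = ∫⁻ z, ENNReal.ofReal (tube z) ∂P :=
    lintegral_comp_flow_localGibbsLaw_const σ a θ u N Φ r (g := fun w => ENNReal.ofReal (tube w)) htubem.ennreal_ofReal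
  have e2a : ∫⁻ z, (2 * eventSum Φ r (r + h) (splitEvent E) z + M (Φ.flow r z)) ∂P =
      ∫⁻ z, 2 * eventSum Φ r (r + h) (splitEvent E) z ∂P + ∫⁻ z, M (Φ.flow r z) ∂P :=
    lintegral_add_right _ (hMm.comp (Φ.measurable_flow r))
  have e2b : ∫⁻ z, 2 * eventSum Φ r (r + h) (splitEvent E) z ∂P = 2 * ∫⁻ z, eventSum Φ r (r + h) (splitEvent E) z ∂P :=
    lintegral_const_mul' 2 _ ENNReal.ofNat_ne_top
  have e2c : ∫⁻ z, M (Φ.flow r z) ∂P = ∫⁻ w, M w ∂P := lintegral_comp_flow_localGibbsLaw_const σ a θ u N Φ r hMm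
  have e2 : ∫⁻ z, (2 * eventSum Φ r (r + h) (splitEvent E) z + M (Φ.flow r z)) ∂P =
      2 * ∫⁻ z, eventSum Φ r (r + h) (splitEvent E) z ∂P + ∫⁻ w, M w ∂P := by rw [e2a, e2b, e2c]
  have e4 : ENNReal.ofReal (∫ w, tube w ∂P) = ∫⁻ z, ENNReal.ofReal (tube z) ∂P :=
    ofReal_integral_eq_lintegral_ofReal htubei (ae_of_all _ htube0)
  -- the tube mean
  have hT := splitFloorRung0_tubeMean σ a θ u N Φ hsd ha hθ (fun _ => (1 : ℝ)) continuous_const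
    (fun _ => zero_le_one) Ξ hΞm 1 hΞabs hΞ0 L κ hL hκ.le hΞL hsmallT
  simp only [one_mul, integral_const, smul_eq_mul, mul_one, probReal_univ] at hT
  have hmain : ((N + 1 : ℕ) : ℝ) * N * ((1 - 16 * ovDensity uniformProfile σ) * hsDiameter σ N ^ 2 * h *
      ∫ p : V3 × V3, sphereMark Ξ p.1 p.2 * (localMaxwellian 1 θ u p.1 * localMaxwellian 1 θ u p.2)) ≤
      ∫ w, tube w ∂P := by
    have he : (1 - 16 * ovDensity uniformProfile σ) * hsDiameter σ N ^ 2 * h =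
        (1 - 16 * ovDensity uniformProfile σ) * hsDiameter σ N ^ 3 * κ := by rw [← hκε]; ring
    rw [he]
    simpa only [htube] using hT
  calc _ ≤ ENNReal.ofReal (∫ w, tube w ∂P) := ENNReal.ofReal_le_ofReal hmain
    _ = ∫⁻ z, ENNReal.ofReal (tube (Φ.flow r z)) ∂P := by rw [e4, e1]
    _ ≤ ∫⁻ z, (2 * eventSum Φ r (r + h) (splitEvent E) z + M (Φ.flow r z)) ∂P := lintegral_mono_ae hae
    _ = 2 * ∫⁻ z, eventSum Φ r (r + h) (splitEvent E) z ∂P + ∫⁻ w, M w ∂P := e2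
    _ ≤ 2 * ∫⁻ z, eventSum Φ r (r + h) (splitEvent E) z ∂P + _ := add_le_add le_rfl hMI

/-! ## The clock -/

/-- `(N+1) ε_N² = κ_N = σ² (N+1)^{1/3}`. [folklore] -/
theorem succ_mul_hsDiameter_sq_eq_clock (σ : ℝ) (N : ℕ) : ((N + 1 : ℕ) : ℝ) * hsDiameter σ N ^ 2 = clock σ N := by
  have hcast : ((N + 1 : ℕ) : ℝ) = (N : ℝ) + 1 := by push_cast; ring
  have hn : (0 : ℝ) < (N : ℝ) + 1 := by positivity
  have hdiam : hsDiameter σ N ^ 2 = σ ^ 2 * ((N : ℝ) + 1) ^ (-(2 / 3 : ℝ)) := by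
    rw [hsDiameter, hcast, mul_pow, ← Real.rpow_natCast (((N : ℝ) + 1) ^ (-(1 / 3 : ℝ))) 2, ← Real.rpow_mul hn.le]
    norm_num
  have hpow : ((N : ℝ) + 1) * ((N : ℝ) + 1) ^ (-(2 / 3 : ℝ)) = ((N : ℝ) + 1) ^ ((1 : ℝ) / 3) := by
    rw [show ((1 : ℝ) / 3) = 1 + (-(2 / 3 : ℝ)) by norm_num, Real.rpow_add hn, Real.rpow_one]
  rw [hdiam, clock, hcast, ← hpow]
  ring

/-! ## The registered stub: the splitting floor at rung 0 -/

/-- **Registered stub `stub_splitFloorRung0` — the RUNG-0 CERTIFICATE of the splitting floor F3** (`SplitFloor` of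
`…LevelCensusObjects` at constant profiles `a, θb > 0`, `u`; line `level-census-comparison`, crux `EnergyCurrentTails`,
stmt-AtomisticToContinuum-9235).  Under the homogeneous Gibbs law (invariant under every hard-sphere flow), for
`0 < σ < σ₀`, every flow family, `N ≥ 1`, `0 ≤ s ≤ s'` and `E ≥ Eth(u, θb)`:
`c κ_N √E (s' − s) · inf_{r ∈ [s,s']} E#{i : E < ‖vᵢ(r)‖² ≤ 3E/2} ≤ E#{splitting collisions at level E in (s, s']}`
with `c = c_geo(u, θb)/8`.  Proof: fixed-`N` small windows — split `(s, s']` into `K` windows of length `h = (s'−s)/K`;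
each has expected floor `(N+1)N(1−16λ)ε²hΘ̄ − C_N h²` (`splitFloorRung0_window`, `sum_eventCount_le`), let `K → ∞`
(`le_of_forall_nat_le_add`); `Θ̄ ≥ c_geo √E N(u,θb)(shell)` (`splitFloorRung0_geometry`), the census at time `s` is
`(N+1) N(u,θb)(shell)` (`shellCensus_const`), `(N+1)ε_N² = κ_N`, `1 − 16λ ≥ 1/2`, `N ≥ (N+1)/2`. [folklore] -/
theorem stub_splitFloorRung0 : ∀ (a θb : ℝ) (u : V3), 0 < a → 0 < θb → ∃ σ₀ : ℝ, 0 < σ₀ ∧ ∀ σ : ℝ, 0 < σ → σ < σ₀ → ∀ Φ : (N : ℕ) → HardSphereFlow (Torus.geometry (Fin 3)) (hsDiameter σ N) (N + 1), ∃ c : ℝ, 0 < c ∧ ∃ Eth : ℝ, ∃ N₃ : ℕ, ∀ N : ℕ, N₃ ≤ N → ∀ s s' : ℝ, 0 ≤ s → s ≤ s' → ∀ E : ℝ, Eth ≤ E → ENNReal.ofReal (c * clock σ N * Real.sqrt E * (s' - s)) * (⨅ r ∈ Set.Icc s s', shellCensus σ (fun _ => a) (fun _ => θb) (fun _ => u)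 N (Φ N) r E (3 / 2 * E)) ≤ eventCount σ (fun _ => a) (fun _ => θb) (fun _ => u) N (Φ N) s s' (splitEvent E) := by
  intro a θb u ha hθ
  -- small density: `SmallDensity` and `16 λ ≤ 1/2`
  obtain ⟨σ₁, hσ₁, hsmall1⟩ := exists_smallDensity uniformProfile one_pos
  have hcont : Tendsto (fun σ : ℝ => ovDensity uniformProfile σ) (nhds 0) (nhds 0) := by
    have hc : Continuous fun σ : ℝ => ovDensity uniformProfile σ := by unfold ovDensity; fun_prop
    simpa [ovDensity] using hc.tendsto 0
  obtain ⟨σ₂, hσ₂, hσ₂prop⟩ : ∃ σ₂ > 0, ∀ σ : ℝ, |σ| < σ₂ → ovDensity uniformProfile σ < 1 / 32 := by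
    rcases Metric.eventually_nhds_iff.1 (hcont (Iio_mem_nhds (by norm_num : (0 : ℝ) < 1 / 32))) with ⟨δ, hδ, hδp⟩
    exact ⟨δ, hδ, fun σ hσ => hδp (by simpa [Real.dist_eq] using hσ)⟩
  refine ⟨min σ₁ σ₂, lt_min hσ₁ hσ₂, ?_⟩
  intro σ hσ hσlt Φ
  have hsd : SmallDensity uniformProfile σ := (hsmall1 σ hσ (hσlt.trans_le (min_le_left _ _))).1
  have hσ2 : σ < 1 / 2 := hsd.σ_lt_half
  have hlam : 1 / 2 ≤ 1 - 16 * ovDensity uniformProfile σ := by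
    have := hσ₂prop σ (by rw [abs_of_pos hσ]; exact hσlt.trans_le (min_le_right _ _)); linarith
  -- the splitting mark and its geometric floor
  obtain ⟨cg, Eth, hcg, hEth, hgeo⟩ := splitFloorRung0_geometry θb u hθ
  refine ⟨cg / 8, by positivity, Eth, 1, ?_⟩
  intro N hN s s' hs hss' E hE
  obtain ⟨Ξ, hΞm, hΞ0, hΞ1, hΞs, hΞL, hΞV, hΘ⟩ := hgeo E hE
  have hL0 : 0 ≤ 2 * Real.sqrt E := by positivity
  have hΞs' : ∀ n v w : V3, ‖n‖ = 1 → Ξ (n, v, w) ≠ 0 →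
      (((v, w), (v - ⟪v - w, n⟫_ℝ • n, w + ⟪v - w, n⟫_ℝ • n)) : VelEvent) ∈ splitEvent E := by
    intro n v w _ hne
    simpa only [splitEvent, maxPre, Set.mem_setOf_eq] using hΞs n v w hne
  -- abbreviations
  set Θ : ℝ := ∫ p : V3 × V3, sphereMark Ξ p.1 p.2 * (localMaxwellian 1 θb u p.1 * localMaxwellian 1 θb u p.2) with hΘd
  set A : ℝ := ((N + 1 : ℕ) : ℝ) * N * ((1 - 16 * ovDensity uniformProfile σ) * hsDiameter σ N ^ 2 * Θ) with hA
  set B : ℝ := (((N + 1 : ℕ) : ℝ) ^ 7 + ((N + 1 : ℕ) : ℝ) ^ 8) * (1024 * hsDiameter σ N ^ 4 * (‖u‖ ^ 2 + 3 * θb))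
    with hB
  set γS : ℝ≥0∞ := gaussMeasure u θb {v : V3 | E < ‖v‖ ^ 2 ∧ ‖v‖ ^ 2 ≤ 3 / 2 * E} with hγS
  have hγS' : γS = ENNReal.ofReal γS.toReal := (ENNReal.ofReal_toReal (measure_ne_top _ _)).symm
  -- (1) the main estimate: `ofReal (A (s' - s)) ≤ 2 · eventCount (s, s']`
  have hmain : ENNReal.ofReal (A * (s' - s)) ≤
      2 * eventCount σ (fun _ => a) (fun _ => θb) (fun _ => u) N (Φ N) s s' (splitEvent E) := by
    rcases eq_or_lt_of_le hss' with heq | hlt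
    · rw [heq, sub_self, mul_zero, ENNReal.ofReal_zero]; exact bot_le
    have hT : 0 < s' - s := sub_pos.2 hlt
    have hε := hsDiameter_pos hσ N
    have hden : 0 < 1 / 2 - hsDiameter σ N := by linarith [hsDiameter_le hσ.le N]
    obtain ⟨K₀, hK₀⟩ := exists_nat_gt (4 * (2 * Real.sqrt E) * (s' - s) / (1 / 2 - hsDiameter σ N))
    refine le_of_forall_nat_le_add (B := B * (s' - s) ^ 2) (by positivity) K₀ fun K hK₀K hKpos => ?_
    have hK : (0 : ℝ) < K := by exact_mod_cast hKpos
    set h : ℝ := (s' - s) / K with hhd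
    have hh0 : 0 < h := div_pos hT hK
    have hhK : h * K = s' - s := by rw [hhd]; field_simp
    have hsmall : hsDiameter σ N + 4 * (2 * Real.sqrt E) * h < 1 / 2 := by
      have h1 : 4 * (2 * Real.sqrt E) * (s' - s) / (1 / 2 - hsDiameter σ N) < K := hK₀.trans_le (by exact_mod_cast hK₀K)
      rw [div_lt_iff₀ hden, ← hhK] at h1
      nlinarith [mul_pos hh0 hK, hL0]
    -- per window, then summed over the `K` windows
    have hwin : ∀ k : ℕ, ENNReal.ofReal (A * h) ≤ 2 * eventCount σ (fun _ => a) (fun _ => θb) (fun _ => u) N (Φ N)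
        (s + k * h) (s + k * h + h) (splitEvent E) + ENNReal.ofReal (B * h ^ 2) := by
      intro k
      have hw := splitFloorRung0_window σ hσ hσ2 hsd a θb ha hθ u N (Φ N) E (2 * Real.sqrt E) hL0 Ξ hΞm hΞ0 hΞ1
        hΞL hΞV hΞs' (s + k * h) h hh0 hsmall
      have eA : A * h = ((N + 1 : ℕ) : ℝ) * N * ((1 - 16 * ovDensity uniformProfile σ) * hsDiameter σ N ^ 2 * h * Θ) := by
        rw [hA]; ring
      have eB : B * h ^ 2 = (((N + 1 : ℕ) : ℝ) ^ 7 + ((N + 1 : ℕ) : ℝ) ^ 8) *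
          (1024 * hsDiameter σ N ^ 4 * (‖u‖ ^ 2 + 3 * θb) * h ^ 2) := by rw [hB]; ring
      rw [eA, eB]
      exact hw
    have hsum := Finset.sum_le_sum fun k (_ : k ∈ Finset.range K) => hwin k
    rw [Finset.sum_const, Finset.card_range, Finset.sum_add_distrib, Finset.sum_const, Finset.card_range,
      ← Finset.mul_sum, nsmul_eq_mul, nsmul_eq_mul] at hsum
    have hcount := sum_eventCount_le hσ hσ2 (fun _ => a) (fun _ => θb) (fun _ => u) (Φ N) s hh0.le
      (measurableSet_splitEvent' E) K
    rw [show s + (K : ℝ) * h = s' by rw [mul_comm, hhK]; ring] at hcount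
    have e1 : (K : ℝ≥0∞) * ENNReal.ofReal (A * h) = ENNReal.ofReal (A * (s' - s)) := by
      rw [← ENNReal.ofReal_natCast, ← ENNReal.ofReal_mul (Nat.cast_nonneg _), ← hhK]; congr 1; ring
    have e2 : (K : ℝ≥0∞) * ENNReal.ofReal (B * h ^ 2) = ENNReal.ofReal (B * (s' - s) ^ 2 / K) := by
      rw [← ENNReal.ofReal_natCast, ← ENNReal.ofReal_mul (Nat.cast_nonneg _), ← hhK]; congr 1; field_simp
    calc ENNReal.ofReal (A * (s' - s)) = (K : ℝ≥0∞) * ENNReal.ofReal (A * h) := e1.symm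
      _ ≤ 2 * ∑ k ∈ Finset.range K, eventCount σ (fun _ => a) (fun _ => θb) (fun _ => u) N (Φ N)
            (s + k * h) (s + k * h + h) (splitEvent E) + (K : ℝ≥0∞) * ENNReal.ofReal (B * h ^ 2) := hsum
      _ ≤ 2 * eventCount σ (fun _ => a) (fun _ => θb) (fun _ => u) N (Φ N) s s' (splitEvent E) +
            ENNReal.ofReal (B * (s' - s) ^ 2 / K) := by rw [e2]; gcongr
  -- (2) the census at time `s` and the final algebra
  have hcensus : (⨅ r ∈ Set.Icc s s', shellCensus σ (fun _ => a) (fun _ => θb) (fun _ => u) N (Φ N) r E (3 / 2 * E)) ≤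
      ((N + 1 : ℕ) : ℝ≥0∞) * γS :=
    (iInf₂_le s ⟨le_rfl, hss'⟩).trans (le_of_eq (shellCensus_const' hσ2.le ha hθ u N (Φ N) s E (3 / 2 * E)))
  have hreal : cg / 8 * clock σ N * Real.sqrt E * (s' - s) * (((N + 1 : ℕ) : ℝ) * γS.toReal) ≤ A * (s' - s) / 2 := by
    have hP0 : 0 ≤ cg * Real.sqrt E * γS.toReal := by positivity
    have k1 : 1 / 2 * (cg * Real.sqrt E * γS.toReal) ≤ (1 - 16 * ovDensity uniformProfile σ) * Θ :=
      mul_le_mul hlam hΘ hP0 (by linarith)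
    have hN1 : (1 : ℝ) ≤ N := by exact_mod_cast hN
    have k2 : cg / 8 * Real.sqrt E * γS.toReal * ((N + 1 : ℕ) : ℝ) ≤
        N * ((1 - 16 * ovDensity uniformProfile σ) * Θ) / 2 := by
      push_cast
      nlinarith [mul_le_mul_of_nonneg_left k1 (Nat.cast_nonneg N), mul_le_mul_of_nonneg_right hN1 hP0]
    have hX0 : 0 ≤ hsDiameter σ N ^ 2 * (s' - s) * ((N + 1 : ℕ) : ℝ) := by
      have := sub_nonneg.2 hss'; positivity
    have eL : cg / 8 * clock σ N * Real.sqrt E * (s' - s) * (((N + 1 : ℕ) : ℝ) * γS.toReal) =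
        (cg / 8 * Real.sqrt E * γS.toReal * ((N + 1 : ℕ) : ℝ)) * (hsDiameter σ N ^ 2 * (s' - s) * ((N + 1 : ℕ) : ℝ)) := by
      rw [← succ_mul_hsDiameter_sq_eq_clock]; ring
    have eR : A * (s' - s) / 2 = (N * ((1 - 16 * ovDensity uniformProfile σ) * Θ) / 2) *
        (hsDiameter σ N ^ 2 * (s' - s) * ((N + 1 : ℕ) : ℝ)) := by rw [hA]; ring
    rw [eL, eR]
    exact mul_le_mul_of_nonneg_right k2 hX0
  have hnn : 0 ≤ cg / 8 * clock σ N * Real.sqrt E * (s' - s) := by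
    have := sub_nonneg.2 hss'
    have : 0 ≤ clock σ N := by unfold clock; positivity
    positivity
  calc ENNReal.ofReal (cg / 8 * clock σ N * Real.sqrt E * (s' - s)) *
        (⨅ r ∈ Set.Icc s s', shellCensus σ (fun _ => a) (fun _ => θb) (fun _ => u) N (Φ N) r E (3 / 2 * E))
      ≤ ENNReal.ofReal (cg / 8 * clock σ N * Real.sqrt E * (s' - s)) * (((N + 1 : ℕ) : ℝ≥0∞) * γS) :=
        mul_le_mul' le_rfl hcensus
    _ = ENNReal.ofReal (cg / 8 * clock σ N * Real.sqrt E * (s' - s) * (((N + 1 : ℕ) : ℝ) * γS.toReal)) := by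
        rw [hγS', ENNReal.toReal_ofReal ENNReal.toReal_nonneg, ← ENNReal.ofReal_natCast,
          ← ENNReal.ofReal_mul (Nat.cast_nonneg _), ← ENNReal.ofReal_mul hnn]
    _ ≤ ENNReal.ofReal (A * (s' - s) / 2) := ENNReal.ofReal_le_ofReal hreal
    _ = ENNReal.ofReal (A * (s' - s)) / 2 := by
        rw [ENNReal.ofReal_div_of_pos two_pos, ENNReal.ofReal_ofNat]
    _ ≤ eventCount σ (fun _ => a) (fun _ => θb) (fun _ => u) N (Φ N) s s' (splitEvent E) :=
        ENNReal.div_le_of_le_mul' hmain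

end Summit.AtomisticToContinuum.HydrodynamicLimit.Theorems.EnergyCurrentTailsLevelCensus

end
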